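import Literature.Analysis.FluidPDE.ElgindiStripCalculusTwo
import Literature.Analysis.FluidPDE.ElgindiStripCalculus
import Mathlib.Analysis.SpecialFunctions.Trigonometric.ArctanDeriv
import HarnessLib

/-!
# Radial iterates of functions smooth on the open strip ([Elgindi2021] §7.3)

Topic `Literature/Analysis/FluidPDE`. Proof file (everything proved, no definitions, no named
facts) on the proof path of the named fact
`Literature.Analysis.FluidPDE.Elgindi.ElgindiGhoulMasmoudi2021_stabilityCore`
(`ElgindiStabilityDecomposition.lean`). T. M. Elgindi, Ann. of Math. 194 (2021) =
arXiv:1904.04795, §7.3 (p. 21: "`D_R` commutes with the equation").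

Small calculus facts for a function `Ψ` that is `C^∞` on the OPEN strip (the smooth representative
of the weak solution): `C^∞(strip)` is stable under `D_R = R∂_R` and `∂_θ`
(`contDiffOn_iterate_Dz_strip`, `contDiffOn_dθ_strip`), and on the strip
`R²∂_RRV = D_R²V − D_RV`, `R∂_RV = D_RV`, `∂_θ(tan θ·V) = tan θ∂_θV + V/cos²θ`, so that the
polar elliptic equation `L(V) = g` can be solved for `∂_θθV`
(`dθdθ_eq_of_ellipticOp_eq`).
-/

noncomputable section

open MeasureTheory Set Real Filter Function
open _root_.Topology
open scoped ContDiff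

namespace Literature.Analysis.FluidPDE

namespace Elgindi

/-- `C^∞(strip)` is stable under `D_R`. [folklore] -/
theorem contDiffOn_iterate_Dz_strip {Ψ : ℝ × ℝ → ℝ} (hΨ : ContDiffOn ℝ ∞ Ψ strip) (j : ℕ) :
    ContDiffOn ℝ ∞ (uncurry (Dz^[j] fun R θ => Ψ (R, θ))) strip := by
  induction j with
  | zero =>
    have e : uncurry (Dz^[0] fun R θ => Ψ (R, θ)) = Ψ := by funext q; rfl
    rw [e]; exact hΨ
  | succ j ih =>
    rw [Function.iterate_succ_apply']
    refine contDiffOn_infty.2 fun m => contDiffOn_Dz (n := (m : ℕ∞)) ?_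
    exact (contDiffOn_infty.1 ih (m + 1)).of_le (by push_cast; exact le_rfl)

/-- `C^∞(strip)` is stable under `∂_θ`. [folklore] -/
theorem contDiffOn_dθ_strip {g : ℝ → ℝ → ℝ} (hg : ContDiffOn ℝ ∞ (uncurry g) strip) :
    ContDiffOn ℝ ∞ (uncurry (dθ g)) strip :=
  contDiffOn_infty.2 fun m => contDiffOn_dθ (n := (m : ℕ∞)) ((contDiffOn_infty.1 hg (m + 1)).of_le (by push_cast; exact le_rfl))

/-- `C^∞(strip)` is stable under `∂_R`. [folklore] -/
theorem contDiffOn_dz_strip {g : ℝ → ℝ → ℝ} (hg : ContDiffOn ℝ ∞ (uncurry g) strip) :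
    ContDiffOn ℝ ∞ (uncurry (dz g)) strip :=
  contDiffOn_infty.2 fun m => contDiffOn_dz (n := (m : ℕ∞)) ((contDiffOn_infty.1 hg (m + 1)).of_le (by push_cast; exact le_rfl))

/-- A finite-order extraction from `C^∞(strip)`. [folklore] -/
theorem contDiffOn_nat_of_infty {g : ℝ → ℝ → ℝ} (hg : ContDiffOn ℝ ∞ (uncurry g) strip) (m : ℕ) :
    ContDiffOn ℝ m (uncurry g) strip := by
  have := contDiffOn_infty.1 hg m; exact_mod_cast this

/-- **`∂_R(D_RV) = ∂_RV + R∂_R∂_RV` on the strip** for `V ∈ C^∞(strip)`. [folklore] -/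
theorem dz_Dz_strip {g : ℝ → ℝ → ℝ} (hg : ContDiffOn ℝ ∞ (uncurry g) strip) {p : ℝ × ℝ} (hp : p ∈ strip) :
    dz (Dz g) p.1 p.2 = dz g p.1 p.2 + p.1 * dz (dz g) p.1 p.2 := by
  have hdz1 : ContDiffOn ℝ 1 (uncurry (dz g)) strip := contDiffOn_nat_of_infty (contDiffOn_dz_strip hg) 1
  have hd : DifferentiableAt ℝ (uncurry (dz g)) p := differentiableAt_of_contDiffOn_strip hdz1 (by simp) hp
  have hc : HasDerivAt (fun R' : ℝ => (R', p.2)) ((1 : ℝ), (0 : ℝ)) p.1 := (hasDerivAt_id p.1).prodMk (hasDerivAt_const p.1 p.2)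
  have h := hd.hasFDerivAt.comp_hasDerivAt p.1 hc
  have e : (fun R' => dz g R' p.2) = uncurry (dz g) ∘ fun R' => (R', p.2) := rfl
  have hslice : HasDerivAt (fun R' => dz g R' p.2) (dz (dz g) p.1 p.2) p.1 := by
    show HasDerivAt (fun R' => dz g R' p.2) (deriv (fun R' => dz g R' p.2) p.1) p.1
    rw [e, h.deriv]; exact h
  have hm : HasDerivAt (fun R' => R' * dz g R' p.2) (1 * dz g p.1 p.2 + p.1 * dz (dz g) p.1 p.2) p.1 :=
    (hasDerivAt_id p.1).mul hslice
  show deriv (fun R' => R' * dz g R' p.2) p.1 = _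
  rw [hm.deriv]; ring

/-- **`R²∂_R∂_RV = D_R²V − D_RV` on the strip.** [folklore] -/
theorem sq_mul_dzdz_eq {g : ℝ → ℝ → ℝ} (hg : ContDiffOn ℝ ∞ (uncurry g) strip) {p : ℝ × ℝ} (hp : p ∈ strip) :
    p.1 ^ 2 * dz (dz g) p.1 p.2 = (Dz^[2] g) p.1 p.2 - (Dz g) p.1 p.2 := by
  have e2 : (Dz^[2] g) p.1 p.2 = p.1 * dz (Dz g) p.1 p.2 := by
    rw [show (Dz^[2] g) = Dz (Dz g) by simp [Function.iterate_succ_apply']]; rfl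
  rw [e2, dz_Dz_strip hg hp]
  show p.1 ^ 2 * dz (dz g) p.1 p.2 = p.1 * (dz g p.1 p.2 + p.1 * dz (dz g) p.1 p.2) - p.1 * dz g p.1 p.2
  ring

/-- **`∂_θ(tan θ·V) = tan θ·∂_θV + V/cos²θ` on the strip.** [folklore] -/
theorem dθ_tan_mul {g : ℝ → ℝ → ℝ} (hg : ContDiffOn ℝ ∞ (uncurry g) strip) {p : ℝ × ℝ} (hp : p ∈ strip) :
    dθ (fun R θ => Real.tan θ * g R θ) p.1 p.2 = Real.tan p.2 * dθ g p.1 p.2 + g p.1 p.2 / Real.cos p.2 ^ 2 := by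
  have hcos : Real.cos p.2 ≠ 0 := (Real.cos_pos_of_mem_Ioo ⟨by linarith [hp.2.1, Real.pi_pos], hp.2.2⟩).ne'
  have h1 : ContDiffOn ℝ 1 (uncurry g) strip := contDiffOn_nat_of_infty hg 1
  have hd : DifferentiableAt ℝ (uncurry g) p := differentiableAt_of_contDiffOn_strip h1 (by simp) hp
  have hc : HasDerivAt (fun θ' : ℝ => (p.1, θ')) ((0 : ℝ), (1 : ℝ)) p.2 := (hasDerivAt_const p.2 p.1).prodMk (hasDerivAt_id p.2)
  have h := hd.hasFDerivAt.comp_hasDerivAt p.2 hc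
  have e : (fun θ' => g p.1 θ') = uncurry g ∘ fun θ' => (p.1, θ') := rfl
  have hslice : HasDerivAt (fun θ' => g p.1 θ') (dθ g p.1 p.2) p.2 := by
    show HasDerivAt (fun θ' => g p.1 θ') (deriv (fun θ' => g p.1 θ') p.2) p.2
    rw [e, h.deriv]; exact h
  have hm : HasDerivAt (fun θ' => Real.tan θ' * g p.1 θ') (1 / Real.cos p.2 ^ 2 * g p.1 p.2 + Real.tan p.2 * dθ g p.1 p.2) p.2 :=
    (Real.hasDerivAt_tan hcos).mul hslice
  show deriv (fun θ' => Real.tan θ' * g p.1 θ') p.2 = _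
  rw [hm.deriv]
  field_simp
  ring

/-- **The polar equation solved for `∂_θθ`**: if `L(V) = g` at `p ∈ strip` (`V ∈ C^∞(strip)`), then
`∂_θθV = tan θ∂_θV + V/cos²θ − 6V − g − α²(D_R²V − D_RV) − α(5+α)D_RV` at `p`. [cite: Elgindi2021, §7 eq. (PolarBSL) (p. 19 of arXiv:1904.04795)] -/
theorem dθdθ_eq_of_ellipticOp_eq {α : ℝ} {V : ℝ → ℝ → ℝ} (hV : ContDiffOn ℝ ∞ (uncurry V) strip) {p : ℝ × ℝ} (hp : p ∈ strip)
    {g : ℝ} (hL : ellipticOp α V p.1 p.2 = g) :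
    dθ (dθ V) p.1 p.2 = Real.tan p.2 * dθ V p.1 p.2 + V p.1 p.2 / Real.cos p.2 ^ 2 - 6 * V p.1 p.2 - g -
      α ^ 2 * ((Dz^[2] V) p.1 p.2 - (Dz V) p.1 p.2) - α * (5 + α) * (Dz V) p.1 p.2 := by
  unfold ellipticOp at hL
  rw [dθ_tan_mul hV hp] at hL
  rw [← sq_mul_dzdz_eq hV hp]
  have eD : (Dz V) p.1 p.2 = p.1 * dz V p.1 p.2 := rfl
  rw [eD]
  linarith

end Elgindi

end Literature.Analysis.FluidPDE
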